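import Mathlib
import HarnessLib
import Summits.Parity.Statement
import Summits.Parity.GeneralizedHardyLittlewood.Theses.ScaleTauberianCarving
import Summits.Parity.GeneralizedHardyLittlewood.Theses.SiegelSpectrumSplit
import Summits.Parity.GeneralizedHardyLittlewood.Theorems.ScaleTauberianCarvingDefs
import Summits.Parity.GeneralizedHardyLittlewood.Theorems.ScaleTauberianCarvingLowerGlue
import Literature.Barriers.Parity.LogarithmicAveraging

/-!
# Route `ScaleTauberianCarving` — exactness and necessity of node G1.2.T (decomp-parity lens-6 g6)

The critic-named package (CRITIC-LEDGER row 63, P1; HOME/STATUS.md l.316) for route-Parity-ScaleTauberianCarving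
(rev 0, commit 71d4b4a7eaf4), re-homed on the BORN route decls and on the record route
route-Parity-SiegelSpectrumSplit (rev 4) BY NAME:

* pattern-local exactness `fixedAt_iff Ψ : FixedAt Ψ ↔ LogWindowHLAt Ψ ∧ ScaleRigidityAt Ψ` (for each fixed
  system separately; the exchange `fixedAt_of_pieces` is the two-sided finite Tauberian exchange of the glue file
  `Theorems/ScaleTauberianCarvingUpperGlue.lean`, `window_core_abs`);
* the born items ARE the pattern-local families (`logWindowHL_iff`, `scaleRigidity_iff`, both `Iff.rfl`);
* leaf exactness, hypothesis-free: `leaf_iff : (FixedUpper ∧ FixedLower) ↔ (LogWindowHL ∧ ScaleRigidity)` with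
  `FixedUpper` = stmt-Parity-26852 and `FixedLower` = stmt-Parity-26863 the record's decls;
* root-level necessity: `logWindowHL_of_ghl`, `scaleRigidity_of_ghl`, `logWindowHL_of_parity`,
  `scaleRigidity_of_parity`; record-level exactness `node_iff` modulo the record's own `GHL → Q`;
* the exchange-rate record `scaleCauchyAt_iff_scaleRigidityAt_of_logWindow` (the uniform-Cauchy spelling and
  the R-form coincide modulo piece A) and the shape-level separation certificates (`not_logWindowShape_const`:
  B-shape without A-shape; `hall_separates`: A-shape without B-shape is Hall's set of the PROVED barrier
  `Literature.Barriers.Parity.LogarithmicAveraging`, `barrier_side`).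

Source: cell kernel `HOME/decomp-parity-lens-6/g6/ScaleTauberianCarving.lean` (@32d8c3ef; critic probe
`critic/ScaleTauberianCarving_lens6g6.lean` rc 0, axioms standard).  Nothing here proves `FixedUpper`, `FixedLower`
or GHL; rung 0.
-/

open scoped BigOperators Pointwise
open Finset Literature.NumberTheory.Sieve

namespace Summit.Parity.GeneralizedHardyLittlewood.ScaleTauberianCarving

open Theses.ScaleTauberianCarving (LogWindowHL ScaleRigidity UpperGlue LowerGlue window_core_abs
  twoSided_of_pieces upperGlue_holds lowerGlue_holds)
open Theses.SiegelSpectrumSplit (FixedUpper FixedLower)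

variable {d t : ℕ}

/-! ## Dilation bookkeeping -/

/-- The image spelling of `dil` is the pointwise dilate `(n/N) • K`. -/
theorem dil_eq_smul (N n : ℕ) (K : Set (Fin d → ℝ)) : dil N n K = ((n : ℝ) / (N : ℝ)) • K :=
  Set.image_smul

/-- Dilates of convex bodies are convex. -/
theorem convex_dil {K : Set (Fin d → ℝ)} (hK : Convex ℝ K) (N n : ℕ) : Convex ℝ (dil N n K) := by
  rw [dil_eq_smul]; exact hK.smul _

/-- The dilate of a body `K ⊆ [-N,N]^d` to scale `n` lies in `[-n,n]^d` (`N ≠ 0`). -/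
theorem dil_subset_realBox {K : Set (Fin d → ℝ)} {N n : ℕ} (hN : N ≠ 0)
    (hK : K ⊆ realBox d N) : dil N n K ⊆ realBox d n := by
  intro x hx
  obtain ⟨y, hy, rfl⟩ := hx
  have hy' := hK hy
  simp only [realBox, Set.mem_Icc] at hy' ⊢
  obtain ⟨h1, h2⟩ := hy'
  have hNpos : (0 : ℝ) < N := by exact_mod_cast Nat.pos_of_ne_zero hN
  have hc : (0 : ℝ) ≤ (n : ℝ) / N := by positivity
  have hcN : (n : ℝ) / N * N = n := by field_simp
  refine ⟨fun i => ?_, fun i => ?_⟩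
  · have hi := mul_le_mul_of_nonneg_left (h1 i) hc
    simp only [Pi.smul_apply, smul_eq_mul]
    have : (n : ℝ) / N * (-(N : ℝ)) = -n := by rw [mul_neg, hcN]
    linarith
  · have hi := mul_le_mul_of_nonneg_left (h2 i) hc
    simp only [Pi.smul_apply, smul_eq_mul]
    linarith

/-! ## The born items ARE the pattern-local families -/

/-- The born item `LogWindowHL` (stmt-Parity-31399) is, definitionally, the family of pattern-local
statements `LogWindowHLAt Ψ` over all `d, t ≥ 1` and all non-degenerate `Ψ`. -/
theorem logWindowHL_iff :
    LogWindowHL ↔ ∀ (d t : ℕ), 1 ≤ d → 1 ≤ t → ∀ Ψ : Fin t → AffLinForm d, IsNondegenerateSystem Ψ →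
      LogWindowHLAt Ψ :=
  Iff.rfl

/-- Likewise for the born item `ScaleRigidity` (stmt-Parity-31400) and `ScaleRigidityAt`. -/
theorem scaleRigidity_iff :
    ScaleRigidity ↔ ∀ (d t : ℕ), 1 ≤ d → 1 ≤ t → ∀ Ψ : Fin t → AffLinForm d, IsNondegenerateSystem Ψ →
      ScaleRigidityAt Ψ :=
  Iff.rfl

/-- `Fixed` is, definitionally, the record's `FixedUpper ∧ FixedLower` folded into one two-sided bound per
system (`fixed_iff` below gives the propositional equivalence with the record decls). -/
theorem fixed_iff_forall :
    Fixed ↔ ∀ (d t : ℕ), 1 ≤ d → 1 ≤ t → ∀ Ψ : Fin t → AffLinForm d, IsNondegenerateSystem Ψ → FixedAt Ψ :=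
  Iff.rfl

/-! ## Exactness and necessity, pattern by pattern -/

/-- The uniform-Cauchy spelling implies the R-form trivially (restrict to `n ≤ N²`). -/
theorem scaleRigidityAt_of_scaleCauchyAt (Ψ : Fin t → AffLinForm d) (h : ScaleCauchyAt Ψ) :
    ScaleRigidityAt Ψ := by
  intro ε hε
  obtain ⟨N₀, hN₀⟩ := h ε hε
  exact ⟨N₀, fun N hN n hn _ K hK hKN => hN₀ N hN n hn K hK hKN⟩

/-- **Exactness (pattern-local)**: pieces A and B at `Ψ` give the two-sided fixed-pattern asymptotic for `Ψ`
(finite Tauberian exchange `window_core_abs` on the window `(N, N²]`). -/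
theorem fixedAt_of_pieces (Ψ : Fin t → AffLinForm d) (hA : LogWindowHLAt Ψ) (hB : ScaleRigidityAt Ψ) :
    FixedAt Ψ := by
  intro ε hε
  obtain ⟨NA, hNA⟩ := hA (ε / 3) (by positivity)
  obtain ⟨NB, hNB⟩ := hB (ε / 3) (by positivity)
  refine ⟨max (max NA NB) 2, fun N hN K hK hKN => ?_⟩
  have hNA' : NA ≤ N := le_trans (le_trans (le_max_left _ _) (le_max_left _ _)) hN
  have hNB' : NB ≤ N := le_trans (le_trans (le_max_right _ _) (le_max_left _ _)) hN
  have h2 : 2 ≤ N := le_trans (le_max_right _ _) hN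
  have hNM : N < N ^ 2 := by
    rw [pow_two]
    exact lt_mul_of_one_lt_right (by omega) (by omega)
  have key := window_core_abs (g := fun n => err Ψ (dil N n K) n / (n : ℝ) ^ d)
    (a := err Ψ K N / (N : ℝ) ^ d) (by positivity : 0 < ε / 3) hNM (hNA N hNA' (N ^ 2) le_rfl K hK hKN)
    (fun n hn => hNB N hNB' n (le_of_lt (Finset.mem_Ioc.mp hn).1) (Finset.mem_Ioc.mp hn).2 K hK hKN)
  have hNd : (0 : ℝ) < (N : ℝ) ^ d := by positivity
  rw [abs_div, abs_of_pos hNd, div_le_iff₀ hNd] at key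
  have h3 : 3 * (ε / 3) * (N : ℝ) ^ d = ε * (N : ℝ) ^ d := by ring
  linarith

/-- **Necessity of A (pattern-local)**: the fixed-pattern asymptotic for `Ψ` implies log-window HL for `Ψ`
(termwise: every dilate `(n/N)•K ⊆ [-n,n]^d` is again an admissible convex body at scale `n`). -/
theorem logWindowHLAt_of_fixedAt (Ψ : Fin t → AffLinForm d) (h : FixedAt Ψ) : LogWindowHLAt Ψ := by
  intro ε hε
  obtain ⟨N₀, hN₀⟩ := h ε hε
  refine ⟨max N₀ 1, fun N hN M _ K hK hKN => ?_⟩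
  have hN₀' : N₀ ≤ N := le_trans (le_max_left _ _) hN
  have hN0 : N ≠ 0 := by have := le_trans (le_max_right _ _) hN; omega
  calc |∑ n ∈ Ioc N M, err Ψ (dil N n K) n / (n : ℝ) ^ d / n|
      ≤ ∑ n ∈ Ioc N M, |err Ψ (dil N n K) n / (n : ℝ) ^ d / n| := Finset.abs_sum_le_sum_abs _ _
    _ ≤ ∑ n ∈ Ioc N M, ε * ((1 : ℝ) / n) := by
        apply Finset.sum_le_sum
        intro n hn
        have hnN : N < n := (Finset.mem_Ioc.mp hn).1
        have hn0 : (0 : ℝ) < n := by exact_mod_cast lt_of_le_of_lt (Nat.zero_le N) hnN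
        have hnd : (0 : ℝ) < (n : ℝ) ^ d := by positivity
        have hb := hN₀ n (by omega) (dil N n K) (convex_dil hK N n) (dil_subset_realBox hN0 hKN)
        have h1 : |err Ψ (dil N n K) n| / (n : ℝ) ^ d ≤ ε := by
          rw [div_le_iff₀ hnd]; exact hb
        rw [abs_div, abs_div, abs_of_pos hnd, abs_of_pos hn0,
          div_eq_mul_one_div (|err Ψ (dil N n K) n| / (n : ℝ) ^ d)]
        exact mul_le_mul_of_nonneg_right h1 (by positivity)
    _ = ε * ∑ n ∈ Ioc N M, (1 : ℝ) / n := (Finset.mul_sum _ _ _).symm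

/-- **Necessity of the strong spelling**: the fixed-pattern asymptotic for `Ψ` gives uniform Cauchy of the
normalised error along all dilation chains. -/
theorem scaleCauchyAt_of_fixedAt (Ψ : Fin t → AffLinForm d) (h : FixedAt Ψ) : ScaleCauchyAt Ψ := by
  intro ε hε
  obtain ⟨N₀, hN₀⟩ := h (ε / 2) (by positivity)
  refine ⟨max N₀ 1, fun N hN n hn K hK hKN => ?_⟩
  have hN₀' : N₀ ≤ N := le_trans (le_max_left _ _) hN
  have hN1 : 1 ≤ N := le_trans (le_max_right _ _) hN
  have hN0 : N ≠ 0 := by omega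
  have hNr : (0 : ℝ) < N := by exact_mod_cast hN1
  have hnr : (0 : ℝ) < n := by exact_mod_cast lt_of_lt_of_le hN1 hn
  have hNd : (0 : ℝ) < (N : ℝ) ^ d := by positivity
  have hnd : (0 : ℝ) < (n : ℝ) ^ d := by positivity
  have hb₁ := hN₀ N hN₀' K hK hKN
  have hb₂ := hN₀ n (le_trans hN₀' hn) (dil N n K) (convex_dil hK N n) (dil_subset_realBox hN0 hKN)
  have h₁ : |err Ψ K N / (N : ℝ) ^ d| ≤ ε / 2 := by
    rw [abs_div, abs_of_pos hNd, div_le_iff₀ hNd]; exact hb₁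
  have h₂ : |err Ψ (dil N n K) n / (n : ℝ) ^ d| ≤ ε / 2 := by
    rw [abs_div, abs_of_pos hnd, div_le_iff₀ hnd]; exact hb₂
  calc |err Ψ K N / (N : ℝ) ^ d - err Ψ (dil N n K) n / (n : ℝ) ^ d|
      ≤ |err Ψ K N / (N : ℝ) ^ d| + |err Ψ (dil N n K) n / (n : ℝ) ^ d| := abs_sub _ _
    _ ≤ ε := by linarith

/-- **Necessity of B (pattern-local)**. -/
theorem scaleRigidityAt_of_fixedAt (Ψ : Fin t → AffLinForm d) (h : FixedAt Ψ) : ScaleRigidityAt Ψ :=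
  scaleRigidityAt_of_scaleCauchyAt Ψ (scaleCauchyAt_of_fixedAt Ψ h)

/-- Exchange-rate record: modulo piece A the uniform-Cauchy spelling «the density exists» and the R-form
coincide (both are then equivalent to the fixed-pattern asymptotic). -/
theorem scaleCauchyAt_iff_scaleRigidityAt_of_logWindow (Ψ : Fin t → AffLinForm d) (hA : LogWindowHLAt Ψ) :
    ScaleCauchyAt Ψ ↔ ScaleRigidityAt Ψ :=
  ⟨scaleRigidityAt_of_scaleCauchyAt Ψ,
    fun hB => scaleCauchyAt_of_fixedAt Ψ (fixedAt_of_pieces Ψ hA hB)⟩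

/-- **Pattern-local exactness**: for EACH fixed system separately, the two-sided fixed-pattern asymptotic is
equivalent to (log-window HL ∧ two-scale rigidity) for that system. -/
theorem fixedAt_iff (Ψ : Fin t → AffLinForm d) : FixedAt Ψ ↔ LogWindowHLAt Ψ ∧ ScaleRigidityAt Ψ :=
  ⟨fun h => ⟨logWindowHLAt_of_fixedAt Ψ h, scaleRigidityAt_of_fixedAt Ψ h⟩,
    fun h => fixedAt_of_pieces Ψ h.1 h.2⟩

/-! ## The leaf: `Fixed = FixedUpper ∧ FixedLower`, and global exactness -/

/-- Global exactness against the born items: `Fixed ↔ LogWindowHL ∧ ScaleRigidity`. -/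
theorem fixed_iff_pieces : Fixed ↔ LogWindowHL ∧ ScaleRigidity := by
  constructor
  · intro h
    exact ⟨fun d t hd ht Ψ hΨ => logWindowHLAt_of_fixedAt Ψ (h d t hd ht Ψ hΨ),
      fun d t hd ht Ψ hΨ => scaleRigidityAt_of_fixedAt Ψ (h d t hd ht Ψ hΨ)⟩
  · rintro ⟨hA, hB⟩ d t hd ht Ψ hΨ
    exact fixedAt_of_pieces Ψ (hA d t hd ht Ψ hΨ) (hB d t hd ht Ψ hΨ)

/-- `Fixed ↔ FixedUpper ∧ FixedLower` — the record's two fixed-pattern leaves (route-Parity-SiegelSpectrumSplit,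
stmt-Parity-26852 / 26863) BY NAME. -/
theorem fixed_iff : Fixed ↔ FixedUpper ∧ FixedLower := by
  constructor
  · intro h
    refine ⟨fun d t hd ht Ψ hΨ ε hε => ?_, fun d t hd ht Ψ hΨ ε hε => ?_⟩
    · obtain ⟨N₀, hN₀⟩ := h d t hd ht Ψ hΨ ε hε
      exact ⟨N₀, fun N hN K hK hKN => (abs_sub_le_iff.mp (hN₀ N hN K hK hKN)).1⟩
    · obtain ⟨N₀, hN₀⟩ := h d t hd ht Ψ hΨ ε hε
      exact ⟨N₀, fun N hN K hK hKN => (abs_sub_le_iff.mp (hN₀ N hN K hK hKN)).2⟩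
  · rintro ⟨hU, hL⟩ d t hd ht Ψ hΨ ε hε
    obtain ⟨N₁, h₁⟩ := hU d t hd ht Ψ hΨ ε hε
    obtain ⟨N₂, h₂⟩ := hL d t hd ht Ψ hΨ ε hε
    refine ⟨max N₁ N₂, fun N hN K hK hKN => abs_sub_le_iff.mpr ⟨?_, ?_⟩⟩
    · exact h₁ N (le_trans (le_max_left _ _) hN) K hK hKN
    · exact h₂ N (le_trans (le_max_right _ _) hN) K hK hKN

/-- **Leaf exactness, hypothesis-free**: the record's fixed leaves ⟺ the two born pieces. -/
theorem leaf_iff : (FixedUpper ∧ FixedLower) ↔ (LogWindowHL ∧ ScaleRigidity) :=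
  fixed_iff.symm.trans fixed_iff_pieces

/-- The record's `FixedUpper` from the pieces (agrees with the glue theorem `upperGlue_holds`). -/
theorem fixedUpper_of_pieces (hA : LogWindowHL) (hB : ScaleRigidity) : FixedUpper :=
  (leaf_iff.mpr ⟨hA, hB⟩).1

/-- The record's `FixedLower` from the pieces (agrees with the glue theorem `lowerGlue_holds`). -/
theorem fixedLower_of_pieces (hA : LogWindowHL) (hB : ScaleRigidity) : FixedLower :=
  (leaf_iff.mpr ⟨hA, hB⟩).2

/-! ## Root-level necessity (both pieces are consequences of the GHL conjunct, hence of `Parity`) -/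

/-- A fixed system has size `‖Ψ‖_N ≤ L` for a single `L` and all `N ≥ 1`. (Folklore.) -/
theorem exists_affLinSize_le (Ψ : Fin t → AffLinForm d) :
    ∃ L : ℕ, ∀ N : ℕ, 1 ≤ N → affLinSize Ψ N ≤ L := by
  refine ⟨⌈∑ i, ∑ j, |((Ψ i).coeff j : ℝ)| + ∑ i, |((Ψ i).const : ℝ)|⌉₊, fun N hN => ?_⟩
  refine le_trans ?_ (Nat.le_ceil _)
  unfold affLinSize
  have h : ∀ i, |((Ψ i).const : ℝ) / N| ≤ |((Ψ i).const : ℝ)| := fun i => by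
    rw [abs_div, Nat.abs_cast]
    exact div_le_self (abs_nonneg _) (by exact_mod_cast hN)
  exact add_le_add le_rfl (Finset.sum_le_sum fun i _ => h i)

/-- `GHL → Fixed` (specialise the uniform conjecture to one system of bounded size). -/
theorem fixed_of_ghl (h : _root_.GeneralizedHardyLittlewood) : Fixed := by
  intro d t hd ht Ψ hΨ ε hε
  obtain ⟨L, hL⟩ := exists_affLinSize_le Ψ
  obtain ⟨N₀, hN₀⟩ := h d t L hd ht ε hε
  refine ⟨max N₀ 1, fun N hN K hK hKN => ?_⟩
  exact hN₀ N (le_trans (le_max_left _ _) hN) Ψ hΨ (hL N (le_trans (le_max_right _ _) hN)) K hK hKN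

/-- **Necessity of piece A at the conjunct**: `GHL → LogWindowHL`. -/
theorem logWindowHL_of_ghl (h : _root_.GeneralizedHardyLittlewood) : LogWindowHL :=
  (fixed_iff_pieces.mp (fixed_of_ghl h)).1

/-- **Necessity of piece B at the conjunct**: `GHL → ScaleRigidity`. -/
theorem scaleRigidity_of_ghl (h : _root_.GeneralizedHardyLittlewood) : ScaleRigidity :=
  (fixed_iff_pieces.mp (fixed_of_ghl h)).2

/-- Necessity of piece A at the summit: `Parity → LogWindowHL`. -/
theorem logWindowHL_of_parity (h : _root_.Parity) : LogWindowHL := logWindowHL_of_ghl h.2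

/-- Necessity of piece B at the summit: `Parity → ScaleRigidity`. -/
theorem scaleRigidity_of_parity (h : _root_.Parity) : ScaleRigidity := scaleRigidity_of_ghl h.2

/-- `GHL →` the route's copy of the record item `UniformUpperGivenFixed` (stmt-Parity-26853). -/
theorem uniformUpperGivenFixed_of_ghl (h : _root_.GeneralizedHardyLittlewood) :
    Theses.ScaleTauberianCarving.UniformUpperGivenFixed := by
  intro _ _ d t L hd ht ε hε
  obtain ⟨N₀, hN₀⟩ := h d t L hd ht ε hε
  exact ⟨N₀, fun N hN Ψ hΨ hΨL K hK hKN => (abs_sub_le_iff.mp (hN₀ N hN Ψ hΨ hΨL K hK hKN)).1⟩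

/-- `GHL →` the route's copy of the record item `UniformLowerGivenFixed` (stmt-Parity-26864). -/
theorem uniformLowerGivenFixed_of_ghl (h : _root_.GeneralizedHardyLittlewood) :
    Theses.ScaleTauberianCarving.UniformLowerGivenFixed := by
  intro _ _ d t L hd ht ε hε
  obtain ⟨N₀, hN₀⟩ := h d t L hd ht ε hε
  exact ⟨N₀, fun N hN Ψ hΨ hΨL K hK hKN => (abs_sub_le_iff.mp (hN₀ N hN Ψ hΨ hΨL K hK hKN)).2⟩

/-! ## Deciding theorem from five binders, and record-level exactness -/

/-- **Five binders suffice**: `{Q, UU, UL, LogWindowHL, ScaleRigidity}` give `GeneralizedHardyLittlewood` through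
the route's gate-written `closes`, the two glue items being theorems (`upperGlue_holds`, `lowerGlue_holds`). -/
theorem closes_of_pieces (hQ : Theses.ScaleTauberianCarving.BoundedSiegelZeroQuality)
    (hUU : Theses.ScaleTauberianCarving.UniformUpperGivenFixed)
    (hUL : Theses.ScaleTauberianCarving.UniformLowerGivenFixed)
    (hA : LogWindowHL) (hB : ScaleRigidity) : _root_.GeneralizedHardyLittlewood :=
  Theses.ScaleTauberianCarving.closes hQ hUU hUL hA hB upperGlue_holds lowerGlue_holds

/-- The summit from the five binders plus the Bateman–Horn conjunct. -/
theorem closes_root (hBH : _root_.BatemanHorn) (hQ : Theses.ScaleTauberianCarving.BoundedSiegelZeroQuality)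
    (hUU : Theses.ScaleTauberianCarving.UniformUpperGivenFixed)
    (hUL : Theses.ScaleTauberianCarving.UniformLowerGivenFixed) (hA : LogWindowHL) (hB : ScaleRigidity) :
    _root_.Parity :=
  ⟨hBH, closes_of_pieces hQ hUU hUL hA hB⟩

/-- **Record-level exactness** modulo the record's own `GHL → Q` (Matomäki–Merikoski 2023 / USZ, the hypothesis
of the record's `node_iff`); at LEAF level the node is hypothesis-free (`leaf_iff`). -/
theorem node_iff
    (hQ_of_ghl : _root_.GeneralizedHardyLittlewood → Theses.ScaleTauberianCarving.BoundedSiegelZeroQuality) :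
    _root_.GeneralizedHardyLittlewood ↔
      Theses.ScaleTauberianCarving.BoundedSiegelZeroQuality ∧
        Theses.ScaleTauberianCarving.UniformUpperGivenFixed ∧
          Theses.ScaleTauberianCarving.UniformLowerGivenFixed ∧ LogWindowHL ∧ ScaleRigidity :=
  ⟨fun h => ⟨hQ_of_ghl h, uniformUpperGivenFixed_of_ghl h, uniformLowerGivenFixed_of_ghl h,
      logWindowHL_of_ghl h, scaleRigidity_of_ghl h⟩,
    fun ⟨hQ, hUU, hUL, hA, hB⟩ => closes_of_pieces hQ hUU hUL hA hB⟩

/-! ## Certificates: shape-level separation and the barrier side -/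

/-- B-shape without A-shape: for a CONSTANT normalised error `c` (a δ-world: the density exists with the
wrong constant) the rigidity shape `|c - c| ≤ ε` is trivial (`ε > 0`) while the log-window shape fails as soon
as `ε < |c|` on a non-empty window — the weighted window mean of the constant `c` is `c`.  Hence B ⇏ A and
B ⇏ leaf at the level of shapes. (Folklore.) -/
theorem not_logWindowShape_const {c ε : ℝ} (hε : 0 < ε) (hc : ε < |c|) {N M : ℕ} (hNM : N < M) :
    |c - c| ≤ ε ∧ ¬ |∑ n ∈ Ioc N M, c / n| ≤ ε * ∑ n ∈ Ioc N M, (1 : ℝ) / n := by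
  refine ⟨by simp [hε.le], ?_⟩
  have hS : 0 < ∑ n ∈ Ioc N M, (1 : ℝ) / n := by
    apply Finset.sum_pos
    · intro n hn
      have : 0 < n := lt_of_le_of_lt (Nat.zero_le N) (Finset.mem_Ioc.mp hn).1
      positivity
    · exact ⟨M, Finset.mem_Ioc.mpr ⟨hNM, le_rfl⟩⟩
  have hsum : ∑ n ∈ Ioc N M, c / n = c * ∑ n ∈ Ioc N M, (1 : ℝ) / n := by
    rw [Finset.mul_sum]
    exact Finset.sum_congr rfl fun n _ => by rw [div_eq_mul_one_div]
  rw [hsum, abs_mul, abs_of_pos hS, not_le]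
  exact mul_lt_mul_of_pos_right hc hS

/-- A-shape without B-shape (and without the leaf) is Hall's set, PROVED in the barrier file: it has
logarithmic density `1/2` and no natural density. -/
theorem hall_separates :
    Literature.Barriers.Parity.HasLogDensity Literature.Barriers.Parity.hallSet (1 / 2) ∧
      ∀ δ : ℝ, ¬ Literature.Barriers.Parity.HasNaturalDensity Literature.Barriers.Parity.hallSet δ :=
  ⟨Literature.Barriers.Parity.hasLogDensity_hallSet, Literature.Barriers.Parity.not_hasNaturalDensity_hallSet⟩

/-- The barrier this node carves against (`LogarithmicAveraging`) is a THEOREM of the tree. -/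
theorem barrier_side : Literature.Barriers.Parity.LogarithmicAveraging :=
  Literature.Barriers.Parity.LogarithmicAveraging_holds

end Summit.Parity.GeneralizedHardyLittlewood.ScaleTauberianCarving
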